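import Mathlib.RingTheory.MvPolynomial.Homogeneous
import Mathlib.RingTheory.KrullDimension.Basic
import Summits.ResolutionOfSingularities.ResolutionOfSingularities.Theorems.EquisingularLiftEquisingularLiftNatDirZeroRationalDefs
import HarnessLib

/-!
# Route `EquisingularLift`, crux EL♮ (stmt-ResolutionOfSingularities-20038) / EL♮(3) (stmt-…-20148) — rung TOWER, CONE-FORM / SHADOW-COUPLING re-cut
# `ConeForm`, `TowerPtReg₁`, `TowerPtRam₁`, `TowerRound₁`, `ReachTower₁` (append-only successors of …NatTowerDefs p541504 / …NatTowerRationalDefs p547506)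

res-L1-w45b-lead-2 g2 (lead, text owner), executing res-L1-w45b-plan-1 g14 RULING-5 (K EXACT-TRACE, 2026-08-27T16:37:19Z) on res-D-pv-029 g8's
DESIGN FINDING §F (16:31:11Z). OURS; planning vocabulary of the crux chain, not a statement of any manuscript; AI-written, weaker than expert review.

WHY. The tower invariant's K-clause «the running cone surface `K̃` has exact special-fibre trace the downstairs shadow `K`» has NO supplier at the
base for a general admissible carrier surface `W`: the architecture's only regular O-flat surface through the section is the Member's CONE
`V(Φ₀(c))` (res-type-100 B9 `exists_coneGerm_of_admTC`), whose point-blow-up strict transform has special fibre the CYLINDER over the carrier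
curve `Z₂` — equal to `ReachTower₀`'s seed `St_x W = closure υ⁻¹(W ∖ {x})` iff `W` is an exact cone at `x` (029's witness of «not always»:
`W = V(xy + z³)`). And the transport `K ↦ closure υ₂⁻¹(K ∖ centre)` through a tower point step at `y ∈ closure K`, or through a Čech round whose
centre has a component inside `closure K`, is not free either (029 §F (F3)). RULING-5: (γ-cone) the shadow is seeded with `St_x W` only under a
downstairs CONE-FORM certificate for `W` at `x`, and (γ-forget) the step / round constructors offer the transported shadow only off `closure K`
(resp. when no component of the centre lies in `closure K`, or the round is cone-witnessed) and otherwise — and always — the shadow `∅`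
(after which no cone witness fires). Every specimen of record passes (S-F′: `W′` is the cone over the reduced tangent septic; its cone rounds come
before its fat-point steps).

THE CONE-FORM CERTIFICATE WITHOUT NAMING `k` (the `Reach` slot of K5′ sees neither the base field nor the structure morphism): `ConeForm F₁ x W` :=
there are a minimal system of generators `c̄` of `𝔪_{F₁,x}` (`span c̄ = 𝔪`, `#c̄ = dim`) and a form `φ` of degree `d ≥ 1` in `#c̄` variables whose
coefficients are INFINITELY ROOT-DIVISIBLE elements of `𝒪_{F₁,x}` (`∀ e ≥ 1, ∃ b, bᵉ = coeff`), with `𝓘⟨closure W⟩_x = (φ(c̄))`. For the local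
ring of a closed point of an integral scheme of finite type over an algebraically closed field `k` of characteristic `p` (the supplier's context,
through its model square), an element with `p^j`-th roots for every `j` is a `k`-CONSTANT: write `a = λ + m` (`λ ∈ k`, `m ∈ 𝔪`); if `b^{p^j} = a`
with `b = μ + m′` then `m = m′^{p^j} ∈ 𝔪^{p^j}` (Frobenius is additive), so `m ∈ ⋂ⱼ 𝔪^{p^j} = 0` (Krull); conversely constants of an algebraically
closed field have all roots. So upstairs the supplier reads `φ` as a form with coefficients in `k`, lifts them to `O` and the frame `c̄` to a frame
of `(ker s)_{jx}`, and B9's cone `Φ₀(c)` has special fibre EXACTLY the germ of `W` (029 §F (F4) «by construction»).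

* `ConeForm F₁ x W` — the certificate above;
* `TowerPtReg₁` / `TowerPtRam₁` — `TowerPtReg` / `TowerPtRam` with the new shadow `K′` ranging over {`∅`} ∪ {`closure υ₂⁻¹(K ∖ {y})` if `y ∉ closure K`};
* `TowerRound₁` — `TowerRound₀` with `K′` ranging over {`∅`} ∪ {`closure υ₂⁻¹(K ∖ Z)` if the round is cone-witnessed or `closure (Z ∖ closure K) = Z`};
* `ReachTower₁` — `ReachTower₀` with the seed shadow `K₂ ∈ {∅} ∪ {St_x W if ConeForm F₁ x W}` and the closure under the `₁` constructors;
* `reachTower₁_of_reachDirZero₀` — DIR₀₀ ⊆ TOWER₁ (shadow `∅` throughout), kernel-checked.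
NOSE: `ReachNoseTower₀` (p547506) seeds the shadow `∅` and its constructors map `∅ ↦ closure υ₂⁻¹(∅ ∖ ·) = ∅`, so no cone witness ever fires there
and the coupling clauses would be vacuous — the NOSE-TOWER₀ text stays as registered (RULING-5 (4)). The E-transport coupling flagged in 029 §F (F3)
(`E ↦ closure υ₂⁻¹(E ∖ centre)` at non-regular points of `Ẽ`) is NOT ruled on and left as registered.
-/

set_option linter.dupNamespace false

noncomputable section

open CategoryTheory AlgebraicGeometry TopologicalSpace
open Literature.AlgebraicGeometry.Resolution (IsBlowup stalkIdeal)

namespace Summit.ResolutionOfSingularities.ResolutionOfSingularities.Cruxes.EquisingularLiftNat.Sections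

/-- **Cone-form certificate** (downstairs, base-field-free): `W` is an EXACT CONE at `x` — its ideal germ is generated by a form of degree `d ≥ 1`
in a minimal system of generators of `𝔪_{F₁,x}` whose coefficients are infinitely root-divisible (= constants of the algebraically closed base
field, by Frobenius + Krull in characteristic `p`; module docstring). [OURS · planning vocabulary] -/
def ConeForm (F₁ : Scheme.{0}) (x : F₁) (W : Set F₁) : Prop :=
  ∃ (m d : ℕ) (c : Fin m → F₁.presheaf.stalk x) (φ : MvPolynomial (Fin m) (F₁.presheaf.stalk x)),
    Ideal.span (Set.range c) = IsLocalRing.maximalIdeal (F₁.presheaf.stalk x) ∧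
    ringKrullDim (F₁.presheaf.stalk x) = ((m : ℕ) : WithBot ℕ∞) ∧ 1 ≤ d ∧ φ.IsHomogeneous d ∧
    (∀ (α : Fin m →₀ ℕ) (e : ℕ), 0 < e → ∃ b : F₁.presheaf.stalk x, b ^ e = φ.coeff α) ∧
    stalkIdeal (Scheme.IdealSheafData.vanishingIdeal (⟨closure W, isClosed_closure⟩ : Closeds F₁)) x =
      Ideal.span {MvPolynomial.eval c φ}

/-- **TOWER / (pt-reg) with shadow coupling** — `TowerPtReg` (…NatTowerDefs) whose new shadow `K′` is `∅` (always allowed: forget the cone) or,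
when the blown-up point is OFF `closure K`, the transported `closure υ₂⁻¹(K ∖ {y})`. Downstairs only. -/
def TowerPtReg₁ (F₁₀ : Scheme.{0}) (R₁ : ∀ G : Scheme.{0}, (G ⟶ F₁₀) → Set G → Set G → Set G → Prop) : Prop :=
  ∀ (G G' : Scheme.{0}) (γ : G ⟶ F₁₀) (T E K : Set G) (y : redSub G (closure T) isClosed_closure) (υ₂ : G' ⟶ G)
      (hy : IsClosed ({curvePt G T y} : Set G)) (K' : Set G'),
    R₁ G γ T E K →
    ¬ IsRegularLocalRing ((redSub G (closure T) isClosed_closure).presheaf.stalk y) →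
    IsRegularLocalRing (G.presheaf.stalk (curvePt G T y)) →
    IsBlowup υ₂ (Scheme.IdealSheafData.vanishingIdeal (⟨{curvePt G T y}, hy⟩ : Closeds G)) →
    (K' = ∅ ∨ (curvePt G T y ∉ closure K ∧ K' = closure (υ₂ ⁻¹' (K \ {curvePt G T y})))) →
    R₁ G' (υ₂ ≫ γ) (closure (υ₂ ⁻¹' (T \ {curvePt G T y}))) (υ₂ ⁻¹' {curvePt G T y}) K' ∧
      R₁ G' (υ₂ ≫ γ) (closure (υ₂ ⁻¹' (T \ {curvePt G T y}))) (closure (υ₂ ⁻¹' (E \ {curvePt G T y}))) K'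

/-- **TOWER / (pt-ram) with shadow coupling** — `TowerPtRam` (…NatTowerDefs: curvilinear fat point, three cotangent-independent generators) whose
new shadow `K′` is `∅` or, off `closure K`, the transported one. Downstairs only. -/
def TowerPtRam₁ (F₁₀ : Scheme.{0}) (R₁ : ∀ G : Scheme.{0}, (G ⟶ F₁₀) → Set G → Set G → Set G → Prop) : Prop :=
  ∀ (G G' : Scheme.{0}) (γ : G ⟶ F₁₀) (T E K : Set G) (y : redSub G (closure T) isClosed_closure) (J : G.IdealSheafData)
      (υ₂ : G' ⟶ G) (K' : Set G'),
    R₁ G γ T E K →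
    ¬ IsRegularLocalRing ((redSub G (closure T) isClosed_closure).presheaf.stalk y) →
    ¬ IsRegularLocalRing (G.presheaf.stalk (curvePt G T y)) →
    (J.support : Set G) = {curvePt G T y} →
    (∃ (ℓ : Fin 3 → G.presheaf.stalk (curvePt G T y)) (hℓ : ∀ i, ℓ i ∈ IsLocalRing.maximalIdeal (G.presheaf.stalk (curvePt G T y))),
      stalkIdeal J (curvePt G T y) = Ideal.span (Set.range ℓ) ∧
      LinearIndependent (IsLocalRing.ResidueField (G.presheaf.stalk (curvePt G T y)))
        (fun i => (IsLocalRing.maximalIdeal (G.presheaf.stalk (curvePt G T y))).toCotangent ⟨ℓ i, hℓ i⟩)) →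
    IsBlowup υ₂ J →
    (K' = ∅ ∨ (curvePt G T y ∉ closure K ∧ K' = closure (υ₂ ⁻¹' (K \ {curvePt G T y})))) →
    R₁ G' (υ₂ ≫ γ) (closure (υ₂ ⁻¹' (T \ {curvePt G T y}))) (υ₂ ⁻¹' {curvePt G T y}) K' ∧
      R₁ G' (υ₂ ≫ γ) (closure (υ₂ ⁻¹' (T \ {curvePt G T y}))) (closure (υ₂ ⁻¹' (E \ {curvePt G T y}))) K'

/-- **TOWER / (round-full) with shadow coupling** — `TowerRound₀` (…NatTowerRationalDefs: Čech rounds over a rational carrier, or cone-witnessed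
rounds) whose new shadow `K′` is `∅` or — when the round is cone-witnessed, or no component of the centre lies in `closure K`
(`closure (Z ∖ closure K) = Z`) — the transported `closure υ₂⁻¹(K ∖ Z)`. Downstairs only. -/
def TowerRound₁ (F₉ F₁₀ : Scheme.{0}) (υ' : F₁₀ ⟶ F₉) (Z₉ : Set F₉) (hZ₉ : IsClosed Z₉)
    (R₁ : ∀ G : Scheme.{0}, (G ⟶ F₁₀) → Set G → Set G → Set G → Prop) : Prop :=
  ∀ (G G' : Scheme.{0}) (γ : G ⟶ F₁₀) (T E K : Set G) (hE : IsClosed E) (Z : Set G) (hZ : IsClosed Z) (υ₂ : G' ⟶ G) (K' : Set G'),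
    R₁ G γ T E K →
    Z ⊆ E ∩ T → Z.Nonempty →
    TowerFull F₉ F₁₀ υ' Z₉ hZ₉ G γ Z hZ →
    ((RationalCarrier (redSub F₉ Z₉ hZ₉) ∧
        (∀ x : redSub G Z hZ, IsRegularLocalRing (G.presheaf.stalk (redSubι G Z hZ x))) ∧
        (∀ (i : redSub G Z hZ ⟶ redSub G E hE), i ≫ redSubι G E hE = redSubι G Z hZ →
          ∀ x : redSub G Z hZ, IsRegularLocalRing ((redSub G E hE).presheaf.stalk (i x))) ∧
        DirStepUnobs G E hE Z hZ) ∨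
      ConeWitness G E hE K Z hZ) →
    IsBlowup υ₂ (Scheme.IdealSheafData.vanishingIdeal (⟨Z, hZ⟩ : Closeds G)) →
    (K' = ∅ ∨ ((ConeWitness G E hE K Z hZ ∨ closure (Z \ closure K) = Z) ∧ K' = closure (υ₂ ⁻¹' (K \ Z)))) →
    R₁ G' (υ₂ ≫ γ) (closure (υ₂ ⁻¹' (T \ Z))) (υ₂ ⁻¹' Z) K' ∧
      R₁ G' (υ₂ ≫ γ) (closure (υ₂ ⁻¹' (T \ Z))) (closure (υ₂ ⁻¹' (E \ Z))) K'

/-- **ReachTower₁** — `ReachTower₀` (…NatTowerRationalDefs) with (γ-cone) the seed shadow `K₂ ∈ {∅} ∪ {St_x W = closure υ⁻¹(W ∖ {x}) if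
`ConeForm F₁ x W`}` and (γ-forget) the closure under `TowerPtReg₁`, `TowerPtRam₁`, `TowerRound₁`. Downstairs only; K5′'s `Reach` slot. -/
def ReachTower₁ (F₁ F₂ : Scheme.{0}) (υ : F₂ ⟶ F₁) (x : F₁) (T₂ : Set F₂) (F' : Scheme.{0}) (β : F' ⟶ F₂) (T' : Set F') : Prop :=
  ∃ (W : Set F₁) (K₂ : Set F₂) (F₉ : Scheme.{0}) (β₉ : F₉ ⟶ F₂) (T₉ Z₉ K₉ : Set F₉) (b₉ : Bool) (hZ₉ : IsClosed Z₉)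
    (F₁₀ : Scheme.{0}) (υ' : F₁₀ ⟶ F₉) (γ' : F' ⟶ F₁₀) (E' K' : Set F'),
    x ∈ W ∧ ¬ (υ ⁻¹' {x} ⊆ closure (υ ⁻¹' (W \ {x}))) ∧
    (∃ U : F₁.affineOpens, x ∈ (U : F₁.Opens) ∧
      ((Scheme.IdealSheafData.vanishingIdeal (⟨closure W, isClosed_closure⟩ : Closeds F₁)).ideal U).IsPrincipal) ∧
    υ ⁻¹' {x} ∩ closure (υ ⁻¹' (W \ {x})) ⊆ T₂ ∧
    (K₂ = ∅ ∨ (ConeForm F₁ x W ∧ K₂ = closure (υ ⁻¹' (W \ {x})))) ∧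
    InCarrierReachK F₂ T₂ (υ ⁻¹' {x} ∩ closure (υ ⁻¹' (W \ {x}))) K₂ F₉ β₉ T₉ Z₉ K₉ b₉ ∧
    Z₉ ⊆ T₉ ∧ ¬ (T₉ ⊆ Z₉) ∧
    Set.Finite {z : redSub F₉ Z₉ hZ₉ | ¬ IsRegularLocalRing ((redSub F₉ Z₉ hZ₉).presheaf.stalk z)} ∧
    IsBlowup υ' (Scheme.IdealSheafData.vanishingIdeal (⟨Z₉, hZ₉⟩ : Closeds F₉)) ∧
    (∀ R₁ : (∀ G : Scheme.{0}, (G ⟶ F₁₀) → Set G → Set G → Set G → Prop),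
      R₁ F₁₀ (𝟙 F₁₀) (closure (υ' ⁻¹' (T₉ \ Z₉))) (υ' ⁻¹' Z₉) (closure (υ' ⁻¹' (K₉ \ Z₉))) →
      TowerPtReg₁ F₁₀ R₁ → TowerPtRam₁ F₁₀ R₁ → TowerRound₁ F₉ F₁₀ υ' Z₉ hZ₉ R₁ → R₁ F' γ' T' E' K') ∧
    β = (γ' ≫ υ') ≫ β₉

/-- **DIR₀₀ ⊆ TOWER₁**: every rational-carrier DIR₀ chain is a `ReachTower₁` chain — shadow `∅` at the seed (no cone certificate needed) and
`K′ = ∅` through every direction round (the Čech disjunct with the rational-carrier clause). [OURS · pure logic] -/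
theorem reachTower₁_of_reachDirZero₀ (F₁ F₂ : Scheme.{0}) (υ : F₂ ⟶ F₁) (x : F₁) (T₂ : Set F₂) (F' : Scheme.{0}) (β : F' ⟶ F₂)
    (T' : Set F') (h : ReachDirZero₀ F₁ F₂ υ x T₂ F' β T') : ReachTower₁ F₁ F₂ υ x T₂ F' β T' := by
  obtain ⟨W, F₉, β₉, T₉, Z₉, b₉, hZ₉, F₁₀, υ', γ', E', ⟨hxW, hnot, hWpr, hZT, hinner, hZ₉T₉, hT₉Z₉, hfin, hυ'⟩, hrat, hdir, hβ⟩ := h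
  obtain ⟨K₉, hK₉⟩ := exists_inCarrierReachK F₂ T₂ (υ ⁻¹' {x} ∩ closure (υ ⁻¹' (W \ {x}))) ∅ F₉ β₉ T₉ Z₉ b₉ hinner
  let ReachT : ∀ G : Scheme.{0}, (G ⟶ F₁₀) → Set G → Set G → Set G → Prop := fun G γ T E K =>
    ∀ R₁ : (∀ G : Scheme.{0}, (G ⟶ F₁₀) → Set G → Set G → Set G → Prop),
      R₁ F₁₀ (𝟙 F₁₀) (closure (υ' ⁻¹' (T₉ \ Z₉))) (υ' ⁻¹' Z₉) (closure (υ' ⁻¹' (K₉ \ Z₉))) →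
      TowerPtReg₁ F₁₀ R₁ → TowerPtRam₁ F₁₀ R₁ → TowerRound₁ F₉ F₁₀ υ' Z₉ hZ₉ R₁ → R₁ G γ T E K
  have hreach : ∃ K' : Set F', ReachT F' γ' T' E' K' := by
    refine hdir (fun G γ T E => ∃ K : Set G, ReachT G γ T E K) ⟨closure (υ' ⁻¹' (K₉ \ Z₉)), fun R₁ hseed _ _ _ => hseed⟩ ?_
    intro G G'' γ T E hE Γ hΓ υ₂ ⟨K, hK⟩ hΓET hΓirr hsec hGreg hEreg hunobs hυ₂
    have hstep : ∀ R₁ : (∀ G : Scheme.{0}, (G ⟶ F₁₀) → Set G → Set G → Set G → Prop),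
        R₁ F₁₀ (𝟙 F₁₀) (closure (υ' ⁻¹' (T₉ \ Z₉))) (υ' ⁻¹' Z₉) (closure (υ' ⁻¹' (K₉ \ Z₉))) →
        TowerPtReg₁ F₁₀ R₁ → TowerPtRam₁ F₁₀ R₁ → TowerRound₁ F₉ F₁₀ υ' Z₉ hZ₉ R₁ →
        R₁ G'' (υ₂ ≫ γ) (closure (υ₂ ⁻¹' (T \ Γ))) (υ₂ ⁻¹' Γ) ∅ ∧
          R₁ G'' (υ₂ ≫ γ) (closure (υ₂ ⁻¹' (T \ Γ))) (closure (υ₂ ⁻¹' (E \ Γ))) ∅ := by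
      intro R₁ hseed hreg hram hround
      have hfull : TowerFull F₉ F₁₀ υ' Z₉ hZ₉ G γ Γ hΓ := by
        obtain ⟨δ, hδ, hiso⟩ := hsec
        exact ⟨δ, hδ, inferInstance, inferInstance, δ.surjective⟩
      exact hround G G'' γ T E K hE Γ hΓ υ₂ ∅ (hK R₁ hseed hreg hram hround) hΓET hΓirr.nonempty hfull
        (Or.inl ⟨hrat, hGreg, hEreg, hunobs⟩) hυ₂ (Or.inl rfl)
    exact ⟨⟨∅, fun R₁ hseed hreg hram hround => (hstep R₁ hseed hreg hram hround).1⟩,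
      ⟨∅, fun R₁ hseed hreg hram hround => (hstep R₁ hseed hreg hram hround).2⟩⟩
  obtain ⟨K', hK'⟩ := hreach
  exact ⟨W, ∅, F₉, β₉, T₉, Z₉, K₉, b₉, hZ₉, F₁₀, υ', γ', E', K', hxW, hnot, hWpr, hZT, Or.inl rfl, hK₉, hZ₉T₉, hT₉Z₉, hfin, hυ',
    hK', hβ⟩

end Summit.ResolutionOfSingularities.ResolutionOfSingularities.Cruxes.EquisingularLiftNat.Sections

end
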